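import Literature.AnabelianGeometry.EtaleTheta.Discharge.Sec4GaloisSurjNaturalModel
import Literature.AnabelianGeometry.SemiGraphs.TemperoidsResProofs

/-!
# [EtTh] Thm. 4.4 (i)/(iv) at the genuine temperoid: transport of the Galois surjections along the
# base-change functor `B^temp(φ) : B^temp(Π₁) → B^temp(Π₂)` of a continuous surjection `φ : Π₂ ↠ Π₁`
# (model of the binders `hG`, `hT` of `Thm44Hyp.galoisCompatible_of` and of T44-L09 `HodotCompatible`)

S. Mochizuki, *The étale theta function …*, Publ. RIMS **45** (2009) [MochizukiEtTh2009], Thm. 4.4 (i), proof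
p.321 (PDF p.95) ll.5–6: «The portion of assertion (i) concerning `Ψ^bs` follows immediately from the theory of
temperoids [cf. [SemiAnbd], Proposition 3.2; Theorem A.4]» — i.e. `Ψ^bs : D₁ ⥲ D₂` is (isomorphic to) the functor
`B^temp(φ)` of a continuous isomorphism of tempered fundamental groups, and then `Ψ(A)` is Galois for Galois `A`,
`Aut_{D₁}(A^bs) ⥲ Aut_{D₂}(Ψ(A)^bs)` is compatible with the outer surjections `Π^tp_{X_i} ↠ Aut(−)` (Def. 4.1 (ii)),
and `H_{⊙,1} ↦ H_{⊙,2}`.  S. Mochizuki, *Semi-graphs of anabelioids* [MochizukiSemiAnbd2006], Rmk. 3.1.2 pp.33–34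
(`B^temp(φ)` = restriction of scalars, abc-iut-L3-t2's `BTemp.res`), Prop. 3.2 p.35.

abc-iut cell, layer L2, ROW «galoisSurj NATURALITY cluster at the canonical model» (abc-iut-L2-lead 2026-08-26T02:54:52Z;
seat abc-iut-w5-d013 gen 2), file (F): the MODEL THEOREMS behind the binders `hG` / `hT` of
`BiKummerSetting.Thm44Hyp.galoisCompatible_of` (`Discharge/Sec4GaloisSurjNatural.lean`, SUBDAG-EtTh-Thm44 leaf T44-L09c)
and behind T44-L09 (`Thm44Hyp.HodotCompatible`: `θ(H_{⊙,1}) = H_{⊙,2}`), for the base-change functor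
`F := BTemp.res φ : B^temp(Π₁) ⥤ B^temp(Π₂)` of a continuous SURJECTION `φ : Π₂ ↠ Π₁` of tempered groups (an
isomorphism in Thm. 4.4) and the canonical Galois surjections `galoisSurjOf` of `Sec4GaloisSurjNaturalModel`:
* `aut_transitive_of_isGaloisObj` — `Aut(A)` acts transitively on the points of a Galois object ([SemiAnbd] Rmk 3.1.3);
* `isConnectedObj_res`, **`isGaloisObj_res`** — `F` carries Galois objects to Galois objects (binder `hG`);
* **`galoisSurjOf_res`** — TRANSPORT LAW (binder `hT` in model form): there is `c ∈ Π₂` with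
  `F(galoisSurjOf_A(φ h)) = galoisSurjOf_{F A}(c h c⁻¹)` for all `h ∈ Π₂`;
* `mem_ker_galoisSurjOf_iff_of_mem_orbit`, **`ker_galoisSurjOf_res`** — `Ker(galoisSurjOf_{F A}) = φ⁻¹(Ker(galoisSurjOf_A))`
  ON THE NOSE (the kernels are normal, so the inner ambiguity disappears): the model form of T44-L09.
MODEL file over the L3 vocabulary (no new definition; `F` is written `BTemp.res φ`); nothing of [EtTh] is asserted;
the identification of an abstract `Ψ^bs` with some `B^temp(φ)` IS [SemiAnbd] Prop. 3.2 / Thm. A.4 (abc-iut-L3's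
`TemperoidHomEqRes_holds` gives it for morphisms of temperoids) and is not claimed here; nothing here bears on
[IUTchIII] Cor. 3.12.
-/

noncomputable section

open CategoryTheory Topology

namespace Literature.AnabelianGeometry.SemiGraphs

namespace GaloisObjects

open Literature.AlgebraicGeometry.Frobenioids (IsConnectedObj)
open Literature.AlgebraicGeometry.Frobenioids.QuasiTemperoid.BTempConnected

universe u

variable {G : Type u} [Group G] [TopologicalSpace G] [IsTopologicalGroup G]
  {G₂ : Type u} [Group G₂] [TopologicalSpace G₂] [IsTopologicalGroup G₂]

/-! ### `Aut(A)` is transitive on a Galois object -/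

/-- **`Aut(A)` acts transitively on the points of a Galois object `A` of `B^temp(Π)`** ([SemiAnbd] Rmk. 3.1.3:
`A ≅ Π/N` and `Aut(Π/N) = Π/N` acts simply transitively): `galoisSurjOf_A(b⁻¹a)` moves `a·x_A` to `b·x_A`.
[cite: MochizukiSemiAnbd2006, Rmk 3.1.3 p.34] -/
theorem aut_transitive_of_isGaloisObj (hG : IsTempered G) (A : BTemp G) (hA : IsGaloisObj A) (x y : A.obj.V) :
    ∃ α : Aut A, (α.hom.hom.hom x : A.obj.V) = y := by
  obtain ⟨a, rfl⟩ := exists_ρ_galoisBase_eq hG A hA x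
  obtain ⟨b, rfl⟩ := exists_ρ_galoisBase_eq hG A hA y
  refine ⟨galoisSurjOf hG A hA (b⁻¹ * a), ?_⟩
  rw [galoisSurjOf_apply, mul_inv_rev, inv_inv, mul_inv_cancel_left]

/-! ### Base change along a continuous surjection preserves connected and Galois objects -/

section Res

variable (hG : IsTempered G) (hG₂ : IsTempered G₂) (φ : G₂ →ₜ* G) (hφ : Function.Surjective φ)

include hφ in
omit [IsTopologicalGroup G] [IsTopologicalGroup G₂] in
/-- `B^temp(φ)` of a continuous SURJECTION carries connected objects to connected objects (one orbit stays one
orbit). [cite: MochizukiSemiAnbd2006, Rmk 3.1.2 p.34] -/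
theorem isConnectedObj_res (A : BTemp G) (hA : IsConnectedObj A) : IsConnectedObj ((BTemp.res φ).obj A) := by
  rw [isConnectedObj_iff] at hA ⊢
  obtain ⟨hne, htr⟩ := hA
  refine ⟨hne, fun x₀ x => ?_⟩
  obtain ⟨g, hg⟩ := htr x₀ x
  obtain ⟨h, rfl⟩ := hφ g
  exact ⟨h, by rw [BTemp.res_obj_ρ_apply]; exact hg⟩

include hG hφ in
omit [IsTopologicalGroup G₂] in
/-- **`B^temp(φ)` of a continuous surjection carries GALOIS objects to GALOIS objects** (model of the binder `hG`
of `Thm44Hyp.galoisCompatible_of`; [EtTh] Thm. 4.4 (i): «Ψ(A) is Galois»): given two arrows `ψ₁, ψ₂ : S → F(A)`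
from a connected `S`, move `ψ₂(s)` to `ψ₁(s)` by an automorphism of `A` (transitivity of `Aut(A)`), whose image
under `F` does the job since maps out of a connected object are determined by one value.
[cite: MochizukiEtTh2009, Thm 4.4 (i) p.320 (PDF p.94)] -/
theorem isGaloisObj_res (A : BTemp G) (hA : IsGaloisObj A) : IsGaloisObj ((BTemp.res φ).obj A) := by
  refine ⟨isConnectedObj_res φ hφ A hA.1, fun S hS ψ₁ ψ₂ => ?_⟩
  obtain ⟨s⟩ := nonempty_of_isConnectedObj S hS
  obtain ⟨α, hα⟩ := aut_transitive_of_isGaloisObj hG A hA (ψ₂.hom.hom s) (ψ₁.hom.hom s)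
  refine ⟨(BTemp.res φ).mapIso α, hom_eq_of_apply_eq hS _ _ s ?_⟩
  rw [comp_apply, Functor.mapIso_hom, BTemp.res_map_hom_hom]
  exact hα.symm

include hφ in
/-- **TRANSPORT LAW for the Galois surjections along `B^temp(φ)`** (model of the binder `hT` of
`Thm44Hyp.galoisCompatible_of`; [EtTh] Thm. 4.4 (i)/(iv): `Aut_{D₁}(A^bs) ⥲ Aut_{D₂}(Ψ(A)^bs)` «induced by `Ψ^bs`» is
compatible with the outer surjections `Π^tp_{X_i} ↠ Aut(−)`): there is `c ∈ Π₂` with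
`F(galoisSurjOf_A(φ h)) = galoisSurjOf_{F A}(c h c⁻¹)` for every `h ∈ Π₂` — `c` is the discrepancy between the base
points chosen for `A` and for `F A`.  [cite: MochizukiEtTh2009, Thm 4.4 (i) p.320 (PDF p.94)] -/
theorem galoisSurjOf_res (A : BTemp G) (hA : IsGaloisObj A) :
    ∃ c : G₂, ∀ h : G₂, (BTemp.res φ).map (galoisSurjOf hG A hA (φ h)).hom =
      (galoisSurjOf hG₂ ((BTemp.res φ).obj A) (isGaloisObj_res hG φ hφ A hA) (c * h * c⁻¹)).hom := by
  -- the base point `x'` of `F A`, and `a ∈ Π₂` with `a · x' = x_A`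
  obtain ⟨a, ha⟩ := exists_ρ_galoisBase_eq hG₂ ((BTemp.res φ).obj A) (isGaloisObj_res hG φ hφ A hA)
    (galoisBase hG A hA)
  have ha' : A.obj.ρ (φ a) (galoisBase hG₂ ((BTemp.res φ).obj A) (isGaloisObj_res hG φ hφ A hA)) =
      galoisBase hG A hA := ha
  have hx' : (galoisBase hG₂ ((BTemp.res φ).obj A) (isGaloisObj_res hG φ hφ A hA) : A.obj.V) =
      A.obj.ρ (φ a)⁻¹ (galoisBase hG A hA) := by
    rw [← ha', ρ_inv_apply]
  refine ⟨a⁻¹, fun h => hom_eq_of_apply_eq (isConnectedObj_res φ hφ A hA.1) _ _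
    (galoisBase hG₂ ((BTemp.res φ).obj A) (isGaloisObj_res hG φ hφ A hA)) ?_⟩
  rw [galoisSurjOf_apply_base]
  change ((galoisSurjOf hG A hA (φ h)).hom.hom.hom
      (galoisBase hG₂ ((BTemp.res φ).obj A) (isGaloisObj_res hG φ hφ A hA)) : A.obj.V) =
    A.obj.ρ (φ (a⁻¹ * h * a⁻¹⁻¹)⁻¹) (galoisBase hG₂ ((BTemp.res φ).obj A) (isGaloisObj_res hG φ hφ A hA))
  rw [hx', galoisSurjOf_apply, ← ρ_mul_apply, map_inv φ,
    show (φ (a⁻¹ * h * a⁻¹⁻¹))⁻¹ * (φ a)⁻¹ = (φ a)⁻¹ * (φ h)⁻¹ by rw [map_mul, map_mul, map_inv, inv_inv]; group]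

/-! ### Kernels: `Ker(galoisSurjOf_{F A}) = φ⁻¹ Ker(galoisSurjOf_A)` on the nose -/

/-- The kernel of the Galois surjection is the stabiliser of EVERY point (the stabilisers of a Galois object are
all equal to the normal subgroup `N_A`). [cite: MochizukiSemiAnbd2006, Rmk 3.1.3 p.34] -/
theorem mem_ker_galoisSurjOf_iff_stab (A : BTemp G) (hA : IsGaloisObj A) (x : A.obj.V) (g : G) :
    g ∈ (galoisSurjOf hG A hA).ker ↔ A.obj.ρ g x = x := by
  obtain ⟨a, rfl⟩ := exists_ρ_galoisBase_eq hG A hA x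
  have hn : (galoisSurjOf hG A hA).ker.Normal := by
    rw [ker_galoisSurjOf]
    infer_instance
  constructor
  · intro h
    have h' : a⁻¹ * g * a⁻¹⁻¹ ∈ (galoisSurjOf hG A hA).ker := hn.conj_mem _ h a⁻¹
    rw [inv_inv, mem_ker_galoisSurjOf_iff] at h'
    have h'' := congrArg (A.obj.ρ a) h'
    rwa [← ρ_mul_apply, show a * (a⁻¹ * g * a) = g * a by group, ρ_mul_apply] at h''
  · intro h
    have h' : A.obj.ρ (a⁻¹ * g * a) (galoisBase hG A hA) = galoisBase hG A hA := by
      rw [show a⁻¹ * g * a = a⁻¹ * (g * a) by group, ρ_mul_apply, ρ_mul_apply, h, ρ_inv_apply]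
    have h'' := hn.conj_mem _ ((mem_ker_galoisSurjOf_iff hG A hA _).mpr h') a
    rwa [show a * (a⁻¹ * g * a) * a⁻¹ = g by group] at h''

include hφ in
/-- **T44-L09 at the genuine temperoid: `Ker(galoisSurjOf_{F A}) = φ⁻¹ Ker(galoisSurjOf_A)` ON THE NOSE** for
`F = B^temp(φ)` — for an isomorphism `φ = θ⁻¹` this is `θ(H_A) = H_{F A}` exactly (the kernels being normal, the
outer ambiguity of the transport law is invisible; applied to `A = A_⊙^bs`: `θ(H_{⊙,1}) = H_{⊙,2}`, the binder
`hθ` of `Thm44Hyp.galoisCompatible_of`). [cite: MochizukiEtTh2009, Thm 4.4 (i) p.320 (PDF p.94)] -/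
theorem ker_galoisSurjOf_res (A : BTemp G) (hA : IsGaloisObj A) :
    (galoisSurjOf hG₂ ((BTemp.res φ).obj A) (isGaloisObj_res hG φ hφ A hA)).ker =
      (galoisSurjOf hG A hA).ker.comap φ.toMonoidHom := by
  ext h
  rw [Subgroup.mem_comap,
    mem_ker_galoisSurjOf_iff_stab hG₂ ((BTemp.res φ).obj A) (isGaloisObj_res hG φ hφ A hA)
      (galoisBase hG A hA) h,
    mem_ker_galoisSurjOf_iff_stab hG A hA (galoisBase hG A hA)]
  exact Iff.rfl

end Res

end GaloisObjects

end Literature.AnabelianGeometry.SemiGraphs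

end
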